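import Summits.AtomisticToContinuum.FouriersLaw.Theorems.VanishingNoiseTransferNoiseLocalityStubResponseDensityNoisyDyson3
import Summits.AtomisticToContinuum.FouriersLaw.Theorems.VanishingNoiseTransferNoiseLocalityStubResponseDensityNoisyDyson5
import Summits.AtomisticToContinuum.FouriersLaw.Theorems.VanishingNoiseTransferNoiseLocalityStubResponseDensityNoisyDyson11

/-!
# Flip-noisy response density, step 6: the palindrome duality of the equilibrium embedded chain
(helpers for stub `stub_responseDensityNoisy`)

Helper file `--supports stmt-AtomisticToContinuum-11975` (crux `NoiseLocality`, route
`VanishingNoiseTransfer`, line `relative-flip-energy-transfer`, stub 1b `stub_responseDensityNoisy`),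
namespace `…NoiseLocality.StubResponseDensityNoisy.Dyson`.

Both baths at `T > 0`; `R = R_r`, `Q`, `K = Q ∘ₖ R` the equilibrium resolvent kernel, the uniform flip
and the embedded flip chain; as operators on weighted observables `K F = R (Q F)`, so
`Kⁿ (R F) = (R Q)ⁿ R F` is a PALINDROME in the letters `R, Q`. Since `R* = Θ R Θ` and `Q* = Q`,
`Θ Q = Q Θ` in `L²(π_T)` (`…Dyson5`), the adjoint of the palindrome is its `Θ`-conjugate:

* `equilibrium_toolkit` — `R`, `Q`, `Kⁿ` preserve continuity and the weighted bound `|·| ≤ C e^{ϑH}`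
  (from `…Dyson3` at constant temperatures);
* `integral_gibbs_mul_pow_resolvent_dual` — for continuous `F, G` with `|F|, |G| ≤ C e^{ϑH}` and
  every `n`: `π_T(G · Kⁿ R F) = π_T((Kⁿ R (G∘Θ))∘Θ · F)`.

No definitions.
-/

noncomputable section

open MeasureTheory ProbabilityTheory Filter Topology Set
open scoped NNReal ENNReal

namespace Summit.AtomisticToContinuum.FouriersLaw.Theorems.NoiseLocality.StubResponseDensityNoisy.Dyson

open Literature.MathematicalPhysics.KineticTheory.HeatConduction
open Literature.Probability.Process Literature.MathematicalPhysics.KineticTheory OscillatorChain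

variable {N : ℕ}

section Palindrome

variable {ω₂ lam β γ : ℝ} (hω : 0 < ω₂) (hl : 0 < lam) (hβ : 0 < β) (hγ : 0 < γ) (hN : 0 < N)
  {T : ℝ} (hT : 0 < T) {ϑ : ℝ} (hϑ : 0 < ϑ) (h2ϑT : 2 * ϑ < 1 / (2 * T)) {r : ℝ} (hr : 0 < r)
include hω hl hβ hγ hN hT hϑ h2ϑT hr

/-- **Equilibrium toolkit.** At bath temperatures `(T, T)` there are constants `C_R, C_p ≥ 0` such
that for every continuous `F` with `|F| ≤ C e^{ϑH}` (`C ≥ 0`): `R F` is continuous with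
`|R F| ≤ C C_R e^{ϑH}`, `F ∈ L¹(R(x,·))`; and for all `n`, `Kⁿ F` is continuous, `F ∈ L¹(Kⁿ(x,·))`,
`|Kⁿ F| ≤ C (1 + C_p) e^{ϑH}` (from the joint Feller lemmas of `…Dyson3` at constant temperatures). -/
theorem equilibrium_toolkit :
    ∃ CR Cp : ℝ, 0 ≤ CR ∧ 0 ≤ Cp ∧ ∀ {F : PhaseSpace N → ℝ}, Continuous F → ∀ {C : ℝ}, 0 ≤ C →
      (∀ y, |F y| ≤ C * Real.exp (ϑ * (pinnedChain ω₂ lam β γ).hamiltonian N y)) →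
      ((∀ x, Integrable F ((pinnedChainSemigroup hω hl.le hβ.le hγ.le hN hT.le hT.le).resolventKernel r x)) ∧
        (Continuous fun x => ∫ y, F y ∂((pinnedChainSemigroup hω hl.le hβ.le hγ.le hN hT.le hT.le).resolventKernel r x)) ∧
        ∀ x, |∫ y, F y ∂((pinnedChainSemigroup hω hl.le hβ.le hγ.le hN hT.le hT.le).resolventKernel r x)| ≤
          C * CR * Real.exp (ϑ * (pinnedChain ω₂ lam β γ).hamiltonian N x)) ∧
      ∀ n : ℕ, (∀ x, Integrable F ((((pinnedChainSemigroup hω hl.le hβ.le hγ.le hN hT.le hT.le).embeddedFlipKernel r) ^ n) x)) ∧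
        (Continuous fun x => ∫ y, F y ∂((((pinnedChainSemigroup hω hl.le hβ.le hγ.le hN hT.le hT.le).embeddedFlipKernel r) ^ n) x)) ∧
        ∀ x, |∫ y, F y ∂((((pinnedChainSemigroup hω hl.le hβ.le hγ.le hN hT.le hT.le).embeddedFlipKernel r) ^ n) x)| ≤
          C * (1 + Cp) * Real.exp (ϑ * (pinnedChain ω₂ lam β γ).hamiltonian N x) := by
  set Pc := pinnedChain ω₂ lam β γ with hPc
  set Hm := Pc.hamiltonian N with hHm
  have hHc : Continuous Hm := pinnedChain_continuous_hamiltonian ω₂ lam β γ N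
  have hϑT : ϑ < 1 / (2 * T) := theta_lt_of_two_theta_lt hϑ h2ϑT
  have hT2 : T ≤ 2 * T := by linarith
  -- constant temperatures on the one-point parameter space
  have hwin : ∀ _y : Unit, 0 < T ∧ T ≤ 2 * T ∧ 0 < T ∧ T ≤ 2 * T := fun _ => ⟨hT, hT2, hT, hT2⟩
  obtain ⟨_c, _B, a, b, _hc, _hB, ha, hb, hunif⟩ :=
    lintegral_exp_kernel_resolventKernel_le_unif hω hl hβ hγ hN hT hϑ hϑT hr
  have hRes := (hunif T T hT hT2 hT hT2).2
  obtain ⟨Cp, hCp, hpow⟩ := continuous_integral_embeddedFlipKernel_pow_param hω hl hβ hγ hN hT hϑ h2ϑT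
    (Y := Unit) (τL := fun _ => T) (τR := fun _ => T) continuous_const continuous_const hwin hr
  have hWm : Measurable fun z => Real.exp (ϑ * Hm z) :=
    (Real.continuous_exp.comp (continuous_const.mul hHc)).measurable
  refine ⟨a.toReal + b.toReal, Cp, by positivity, hCp, fun {F} hF {C} hC hFb => ⟨⟨fun x => ?_, ?_, fun x => ?_⟩, fun n => ?_⟩⟩
  · exact (integrable_abs_integral_le_of_lintegral_le hWm (fun z => (Real.exp_pos _).le)
      (ENNReal.add_ne_top.2 ⟨ENNReal.mul_ne_top ha.ne_top ENNReal.ofReal_ne_top, hb⟩) (hRes x)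
      hF.aestronglyMeasurable hC hFb).1
  · have hFc : Continuous fun p : Unit × PhaseSpace N => F p.2 := hF.comp continuous_snd
    have h := (continuous_integral_resolventKernel_param hω hl hβ hγ hN hT hϑ h2ϑT (Y := Unit)
      (τL := fun _ => T) (τR := fun _ => T) continuous_const continuous_const hwin (F := fun _ => F) hFc hC
      (fun _ y => hFb y) hr).2
    have hu : Continuous fun x : PhaseSpace N => ((), x) := (continuous_const (y := ())).prodMk continuous_id
    have h2 := h.comp hu
    exact h2
  · have h := (integrable_abs_integral_le_of_lintegral_le hWm (fun z => (Real.exp_pos _).le)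
      (ENNReal.add_ne_top.2 ⟨ENNReal.mul_ne_top ha.ne_top ENNReal.ofReal_ne_top, hb⟩) (hRes x)
      hF.aestronglyMeasurable hC hFb).2
    rw [toReal_affine ha.ne_top hb (Real.exp_pos _).le] at h
    refine h.trans ?_
    have h1 : 1 ≤ Real.exp (ϑ * Hm x) :=
      Real.one_le_exp (mul_nonneg hϑ.le (pinnedChain_hamiltonian_nonneg hω.le hl.le hβ.le γ N x))
    have := ENNReal.toReal_nonneg (a := a); have := ENNReal.toReal_nonneg (a := b)
    nlinarith [mul_nonneg hC (ENNReal.toReal_nonneg (a := b))]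
  · have hFc : Continuous fun p : Unit × PhaseSpace N => F p.2 := hF.comp continuous_snd
    obtain ⟨hIB, hcont⟩ := hpow (F := fun _ => F) hFc hC (fun _ y => hFb y) n
    have hu : Continuous fun x : PhaseSpace N => ((), x) := (continuous_const (y := ())).prodMk continuous_id
    have h2 := hcont.comp hu
    refine ⟨fun x => (hIB () x).1, h2, fun x => ?_⟩
    refine ((hIB () x).2).trans ?_
    have h1 : 1 ≤ Real.exp (ϑ * Hm x) :=
      Real.one_le_exp (mul_nonneg hϑ.le (pinnedChain_hamiltonian_nonneg hω.le hl.le hβ.le γ N x))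
    nlinarith [mul_nonneg hC hCp]

/-- **The palindrome duality.** Both baths at `T`; for continuous `F, G` with `|F| ≤ C_F e^{ϑH}`,
`|G| ≤ C_G e^{ϑH}` and every `n`:
`π_T(G · Kⁿ R F) = π_T((Kⁿ R (G∘Θ))∘Θ · F)` — the `L²(π_T)`-adjoint of the palindrome
`Kⁿ R = (R Q)ⁿ R` is its `Θ`-conjugate (`R* = Θ R Θ`, `Q* = Q`, `Q Θ = Θ Q`; induction on `n`). -/
theorem integral_gibbs_mul_pow_resolvent_dual (n : ℕ) :
    ∀ {F G : PhaseSpace N → ℝ}, Continuous F → Continuous G → ∀ {CF CG : ℝ},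
      (∀ y, |F y| ≤ CF * Real.exp (ϑ * (pinnedChain ω₂ lam β γ).hamiltonian N y)) →
      (∀ y, |G y| ≤ CG * Real.exp (ϑ * (pinnedChain ω₂ lam β γ).hamiltonian N y)) →
      ∫ x, G x * (∫ y, (∫ z, F z ∂((pinnedChainSemigroup hω hl.le hβ.le hγ.le hN hT.le hT.le).resolventKernel r y))
          ∂((((pinnedChainSemigroup hω hl.le hβ.le hγ.le hN hT.le hT.le).embeddedFlipKernel r) ^ n) x))
          ∂((pinnedChain ω₂ lam β γ).gibbsMeasure N T) =
        ∫ x, (∫ y, (∫ z, G (z.1, -z.2) ∂((pinnedChainSemigroup hω hl.le hβ.le hγ.le hN hT.le hT.le).resolventKernel r y))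
          ∂((((pinnedChainSemigroup hω hl.le hβ.le hγ.le hN hT.le hT.le).embeddedFlipKernel r) ^ n) (x.1, -x.2))) * F x
          ∂((pinnedChain ω₂ lam β γ).gibbsMeasure N T) := by
  set Sg := pinnedChainSemigroup hω hl.le hβ.le hγ.le hN hT.le hT.le with hSg
  set Rk := Sg.resolventKernel r with hRk
  set Kk := Sg.embeddedFlipKernel r with hKk
  haveI : IsMarkovKernel Rk := Sg.isMarkovKernel_resolventKernel hr
  haveI : IsMarkovKernel Kk := Sg.isMarkovKernel_embeddedFlipKernel hr
  haveI : ∀ m : ℕ, IsMarkovKernel (Kk ^ m) := fun m => Harris.isMarkovKernel_pow _ m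
  obtain ⟨CR, Cp, hCR, hCp, htk⟩ := equilibrium_toolkit hω hl hβ hγ hN hT hϑ h2ϑT hr
  -- generic facts
  have hC0 : ∀ {f : PhaseSpace N → ℝ} {C : ℝ}, (∀ y, |f y| ≤ C * Real.exp (ϑ * (pinnedChain ω₂ lam β γ).hamiltonian N y)) → 0 ≤ C := by
    intro f C hfb
    have := (abs_nonneg _).trans (hfb 0); exact nonneg_of_mul_nonneg_left this (Real.exp_pos _)
  have hΘc : Continuous fun x : PhaseSpace N => (x.1, -x.2) := continuous_fst.prodMk continuous_snd.neg
  have hΘb : ∀ {f : PhaseSpace N → ℝ} {C : ℝ}, (∀ y, |f y| ≤ C * Real.exp (ϑ * (pinnedChain ω₂ lam β γ).hamiltonian N y)) →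
      ∀ y : PhaseSpace N, |f (y.1, -y.2)| ≤ C * Real.exp (ϑ * (pinnedChain ω₂ lam β γ).hamiltonian N y) := fun hfb y => by
    have h := hfb (y.1, -y.2); rwa [OscillatorChain.hamiltonian_neg_momentum] at h
  -- products of weighted functions are `π_T`-integrable
  have hprod : ∀ {f g : PhaseSpace N → ℝ}, Continuous f → Continuous g → ∀ {Cf Cg : ℝ},
      (∀ y, |f y| ≤ Cf * Real.exp (ϑ * (pinnedChain ω₂ lam β γ).hamiltonian N y)) → (∀ y, |g y| ≤ Cg * Real.exp (ϑ * (pinnedChain ω₂ lam β γ).hamiltonian N y)) →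
      Integrable (fun x => g x * f x) ((pinnedChain ω₂ lam β γ).gibbsMeasure N T) := by
    intro f g hf hg Cf Cg hfb hgb
    refine integrable_gibbs_of_abs_le hω hl hβ hT h2ϑT (hg.mul hf) (C := Cg * Cf) fun y => ?_
    rw [abs_mul, show 2 * ϑ * (pinnedChain ω₂ lam β γ).hamiltonian N y = ϑ * (pinnedChain ω₂ lam β γ).hamiltonian N y + ϑ * (pinnedChain ω₂ lam β γ).hamiltonian N y by ring, Real.exp_add]
    calc |g y| * |f y| ≤ Cg * Real.exp (ϑ * (pinnedChain ω₂ lam β γ).hamiltonian N y) * (Cf * Real.exp (ϑ * (pinnedChain ω₂ lam β γ).hamiltonian N y)) :=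
          mul_le_mul (hgb y) (hfb y) (abs_nonneg _) ((abs_nonneg _).trans (hgb y))
      _ = _ := by ring
  induction n with
  | zero =>
    intro F G hF hG CF CG hFb hGb
    obtain ⟨⟨-, hRFc, -⟩, -⟩ := htk hF (hC0 hFb) hFb
    have hGΘ : Continuous fun x : PhaseSpace N => G (x.1, -x.2) := hG.comp hΘc
    obtain ⟨⟨-, hRGc, -⟩, -⟩ := htk hGΘ (hC0 hGb) (hΘb hGb)
    have e1 : ∀ x, ∫ y, (∫ z, F z ∂(Rk y)) ∂((Kk ^ 0) x) = ∫ z, F z ∂(Rk x) := fun x => by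
      rw [Harris.pow_zero_apply, integral_dirac' _ _ hRFc.stronglyMeasurable]
    have e2 : ∀ x : PhaseSpace N, ∫ y, (∫ z, G (z.1, -z.2) ∂(Rk y)) ∂((Kk ^ 0) x) =
        ∫ z, G (z.1, -z.2) ∂(Rk x) := fun x => by
      rw [Harris.pow_zero_apply, integral_dirac' _ _ hRGc.stronglyMeasurable]
    simp_rw [e1, e2]
    exact integral_gibbs_mul_resolvent_dual hω hl hβ hγ hN hT hϑ h2ϑT hr hF hG hFb hGb
  | succ n ih =>
    intro F G hF hG CF CG hFb hGb
    have hCF := hC0 hFb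
    have hCG := hC0 hGb
    -- `R F`, `W = Kⁿ R F`, `Q W`
    obtain ⟨⟨hRFI, hRFc, hRFb⟩, hKRF⟩ := htk hF hCF hFb
    set RF : PhaseSpace N → ℝ := fun y => ∫ z, F z ∂(Rk y) with hRF
    have hRFb' : ∀ y, |RF y| ≤ CF * CR * Real.exp (ϑ * (pinnedChain ω₂ lam β γ).hamiltonian N y) := hRFb
    obtain ⟨hWI, hWc, hWb⟩ := (htk hRFc (by positivity) hRFb').2 n
    set W : PhaseSpace N → ℝ := fun x => ∫ y, RF y ∂((Kk ^ n) x) with hW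
    have hWb' : ∀ y, |W y| ≤ CF * CR * (1 + Cp) * Real.exp (ϑ * (pinnedChain ω₂ lam β γ).hamiltonian N y) := hWb
    have hQWb := (flipAverage_continuous_bound (Y := Unit) hN (F := fun _ => W)
      (hWc.comp continuous_snd) (C := CF * CR * (1 + Cp)) (fun _ y => hWb' y)).2 ()
    have hQWc' : Continuous fun x => (N : ℝ)⁻¹ * ∑ i : Fin N, W (momentumFlip i x) :=
      continuous_const.mul (continuous_finsetSum _ fun i _ => hWc.comp (continuous_momentumFlip i))
    -- (I1) `Kⁿ⁺¹ R F = R (Q W)`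
    have hI1 : ∀ x, ∫ y, RF y ∂((Kk ^ (n + 1)) x) = ∫ y, (N : ℝ)⁻¹ * ∑ i : Fin N, W (momentumFlip i y) ∂(Rk x) := by
      intro x
      have hint1 : Integrable RF ((Kk ^ (n + 1)) x) := ((htk hRFc (by positivity) hRFb').2 (n + 1)).1 x
      rw [Harris.pow_succ_eq_comp, Kernel.comp_apply] at hint1 ⊢
      rw [Harris.integral_comp_measure _ _ hint1]
      have hWint : Integrable W (Kk x) := by
        have h := ((htk hWc (by positivity) hWb').2 1).1 x; rwa [pow_one] at h
      exact integral_embeddedFlipKernel_eq Sg hN r x hWint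
    -- `G̃ = G ∘ Θ`, `R G̃`, and the new left factor `G' = Q ((R G̃) ∘ Θ)`
    have hGΘ : Continuous fun x : PhaseSpace N => G (x.1, -x.2) := hG.comp hΘc
    obtain ⟨⟨hRGI, hRGc, hRGb⟩, hKRG⟩ := htk hGΘ hCG (hΘb hGb)
    set RG : PhaseSpace N → ℝ := fun y => ∫ z, G (z.1, -z.2) ∂(Rk y) with hRG
    have hRGb' : ∀ y, |RG y| ≤ CG * CR * Real.exp (ϑ * (pinnedChain ω₂ lam β γ).hamiltonian N y) := hRGb
    have hRGΘc : Continuous fun x : PhaseSpace N => RG (x.1, -x.2) := hRGc.comp hΘc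
    have hG'b := (flipAverage_continuous_bound (Y := Unit) hN (F := fun _ x => RG (x.1, -x.2))
      (hRGΘc.comp continuous_snd) (C := CG * CR) (fun _ y => hΘb hRGb' y)).2 ()
    have hG'c' : Continuous fun x => (N : ℝ)⁻¹ * ∑ i : Fin N, RG ((momentumFlip i x).1, -(momentumFlip i x).2) :=
      continuous_const.mul (continuous_finsetSum _ fun i _ => hRGΘc.comp (continuous_momentumFlip i))
    -- the chain of equalities
    calc ∫ x, G x * (∫ y, RF y ∂((Kk ^ (n + 1)) x)) ∂((pinnedChain ω₂ lam β γ).gibbsMeasure N T)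
        = ∫ x, G x * (∫ y, (N : ℝ)⁻¹ * ∑ i : Fin N, W (momentumFlip i y) ∂(Rk x)) ∂((pinnedChain ω₂ lam β γ).gibbsMeasure N T) := by
          simp_rw [hI1]
      _ = ∫ x, RG (x.1, -x.2) * ((N : ℝ)⁻¹ * ∑ i : Fin N, W (momentumFlip i x)) ∂((pinnedChain ω₂ lam β γ).gibbsMeasure N T) :=
          integral_gibbs_mul_resolvent_dual hω hl hβ hγ hN hT hϑ h2ϑT hr hQWc' hG hQWb hGb
      _ = ∫ x, ((N : ℝ)⁻¹ * ∑ i : Fin N, RG ((momentumFlip i x).1, -(momentumFlip i x).2)) * W x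
            ∂((pinnedChain ω₂ lam β γ).gibbsMeasure N T) :=
          integral_gibbs_mul_flipAverage (pinnedChain ω₂ lam β γ) N T fun i =>
            hprod (hWc.comp (continuous_momentumFlip i)) hRGΘc
              (fun y => by have h := hWb' (momentumFlip i y); rwa [OscillatorChain.hamiltonian_momentumFlip] at h)
              (hΘb hRGb')
      _ = ∫ x, (∫ y, (∫ z, (N : ℝ)⁻¹ * ∑ i : Fin N, RG ((momentumFlip i (z.1, -z.2)).1, -(momentumFlip i (z.1, -z.2)).2)
            ∂(Rk y)) ∂((Kk ^ n) (x.1, -x.2))) * F x ∂((pinnedChain ω₂ lam β γ).gibbsMeasure N T) :=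
          ih hF hG'c' hFb hG'b
      _ = _ := by
          -- (I3) `G' ∘ Θ = Q (R G̃)`, then (I2) `Kⁿ R (Q (R G̃)) = Kⁿ K (R G̃) = Kⁿ⁺¹ R G̃`
          have e3 : ∀ z : PhaseSpace N, (N : ℝ)⁻¹ * ∑ i : Fin N, RG ((momentumFlip i (z.1, -z.2)).1,
              -(momentumFlip i (z.1, -z.2)).2) = (N : ℝ)⁻¹ * ∑ i : Fin N, RG (momentumFlip i z) := fun z => by
            simp only [VanishingNoiseBound.momentumFlip_momentumReversal, neg_neg, Prod.mk.eta]
          have e4 : ∀ y, ∫ z, (N : ℝ)⁻¹ * ∑ i : Fin N, RG (momentumFlip i z) ∂(Rk y) = ∫ z, RG z ∂(Kk y) := by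
            intro y
            have hint : Integrable RG (Kk y) := by
              have h := ((htk hRGc (by positivity) hRGb').2 1).1 y; rwa [pow_one] at h
            exact (integral_embeddedFlipKernel_eq Sg hN r y hint).symm
          have e5 : ∀ w, ∫ y, (∫ z, RG z ∂(Kk y)) ∂((Kk ^ n) w) = ∫ y, RG y ∂((Kk ^ (n + 1)) w) := by
            intro w
            have hint : Integrable RG ((Kk ^ (n + 1)) w) := ((htk hRGc (by positivity) hRGb').2 (n + 1)).1 w
            rw [Harris.pow_succ_eq_comp', Kernel.comp_apply] at hint ⊢
            exact (Harris.integral_comp_measure _ _ hint).symm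
          simp_rw [e3, e4, e5]

end Palindrome

/-- Registered helper sub-goal `helper_responseDensityNoisyDysonPalindrome` of stmt-AtomisticToContinuum-11975
(= `integral_gibbs_mul_pow_resolvent_dual`, fully quantified one-line form). -/
theorem helper_responseDensityNoisyDysonPalindrome : ∀ (ω₂ lam β γ : ℝ) (hω : 0 < ω₂) (hl : 0 < lam) (hβ : 0 < β) (hγ : 0 < γ) (N : ℕ) (hN : 0 < N) (T : ℝ) (hT : 0 < T) (ϑ : ℝ), 0 < ϑ → 2 * ϑ < 1 / (2 * T) → ∀ (r : ℝ), 0 < r → ∀ (n : ℕ) (F G : Literature.MathematicalPhysics.KineticTheory.HeatConduction.PhaseSpace N → ℝ), Continuous F → Continuous G → ∀ (CF CG : ℝ), (∀ y, |F y| ≤ CF * Real.exp (ϑ * (Literature.MathematicalPhysics.KineticTheory.HeatConduction.pinnedChain ω₂ lam β γ).hamiltonian N y)) → (∀ y, |G y| ≤ CG * Real.exp (ϑ * (Literature.MathematicalPhysics.KineticTheory.HeatConduction.pinnedChain ω₂ lam β γ).hamiltonian N y)) → ∫ x, G x * (∫ y, (∫ z, F z ∂((Literature.MathematicalPhysics.KineticTheory.HeatConduction.pinnedChainSemigroup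 hω hl.le hβ.le hγ.le hN hT.le hT.le).resolventKernel r y)) ∂((((Literature.MathematicalPhysics.KineticTheory.HeatConduction.pinnedChainSemigroup hω hl.le hβ.le hγ.le hN hT.le hT.le).embeddedFlipKernel r) ^ n) x)) ∂((Literature.MathematicalPhysics.KineticTheory.HeatConduction.pinnedChain ω₂ lam β γ).gibbsMeasure N T) = ∫ x, (∫ y, (∫ z, G (z.1, -z.2) ∂((Literature.MathematicalPhysics.KineticTheory.HeatConduction.pinnedChainSemigroup hω hl.le hβ.le hγ.le hN hT.le hT.le).resolventKernel r y)) ∂((((Literature.MathematicalPhysics.KineticTheory.HeatConduction.pinnedChainSemigroup hω hl.le hβ.le hγ.le hN hT.le hT.le).embeddedFlipKernel r) ^ n) (x.1, -x.2))) * F x ∂((Literature.MathematicalPhysics.KineticTheory.HeatConduction.pinnedChain ω₂ lam β γ).gibbsMeasure N T) :=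
  fun _ _ _ _ hω hl hβ hγ _ hN _ hT _ hϑ h2ϑT _ hr n _ _ hF hG _ _ hFb hGb =>
    integral_gibbs_mul_pow_resolvent_dual hω hl hβ hγ hN hT hϑ h2ϑT hr n hF hG hFb hGb

end Summit.AtomisticToContinuum.FouriersLaw.Theorems.NoiseLocality.StubResponseDensityNoisy.Dyson

end
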